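import Summits.BirchSwinnertonDyer.BirchSwinnertonDyer.Theorems.PrintCf2SplitBadTwoLocalControlKernelDyadicExact
import Summits.BirchSwinnertonDyer.BirchSwinnertonDyer.Theorems.PrintCf2SplitBadTwoCMPrimaryDyadicTableStrict
import Literature.NumberTheory.GaloisRepresentations.LocalGaloisGroupProofs
import HarnessLib

/-!
# Crux `PrintCf2.SplitBadTwoRankOneOfFacts` (stmt-BirchSwinnertonDyer-20368), road α v10.3 — brick B15 file 9: (R-DYADIC) FOR ODD `d` FROM THE SINGLE
# CFT-SHAPED HYPOTHESIS (C3-loc) «`ker κ' ⊓ D_{v̄}` = the elements of `D_{v̄}` acting on `W*` as `±1`»: `#LK_{v̄} = 1` for `d ≡ 3 (8)`, `= 2` for `d ≡ 7 (8)`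

Cell `bsd-print-cf2`, width seat `bsd-line-cf2-p1-w2` g9 (prover-bsd-line-cf2-p1-w2-g9-0); brick B15 (memo `Cruxes/SplitBadTwoRankOneOfFacts/B15-DYADIC-EXACT-w2g9.md`
§3); `--supports stmt-BirchSwinnertonDyer-20368` (helper, Theses-free). HONEST FRAMING: nothing here closes the crux or a registered stub; BSD is not
proved by any of this; no summit statement is proved by this seat. No definition, no named fact, no `sorry`.

WHAT. On the S3c frame (`W* = E[𝔮_r^∞]` pinned at `v`, kernel type at `v̄`) assume (C3-loc):
`∀ σ ∈ D_{v̄}, σ ∈ ker κ' ↔ (σ acts as +1 on W*) ∨ (σ acts as −1 on W*)` — the local shadow of the class-field-theoretic identity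
`ker κ' = ψ_{W*}⁻¹(±1)` for THE `ℤ₂`-line unramified outside `v̄` (memo (C3); not claimed here). Then:
* **`natCard_localKer_vbar_eq_one_of_frame_of_kerC3`** (`d ≡ 3 (8)`): every `δ ∈ D_{v̄}` fixes `W*[4]` (p664023), so no element of `ker κ' ⊓ D_{v̄}` acts as `−1`;
  hence (Hv̄-triv) and `#LK_{v̄} = 1` (`e_{v̄} = 0`).
* **`natCard_localKer_vbar_eq_two_of_frame_of_kerC3`** (`d ≡ 7 (8)`): an element of `D_{v̄}` acting as `−1` on ALL of `W*` EXISTS — `σ = φ·τ` with `φ` of degree `1`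
  (it fixes `√(−d) ∈ K_{v̄}`, p662192 Hensel) and `τ` an inertia element with `ε(τ) = −α·ε(φ)⁻¹` (`χ₂(I) = ℤ₂ˣ` above a split prime); then
  `χ(σ) = s·ε(σ)·α⁻¹ = −1` exactly — so `σ ∈ ker κ'` moves `W*[4]` ((Hv̄-move)), while an inertia element with `ε = 3` acts as `−3 ≠ ±1`, so
  `D_{v̄} ⊄ ker κ'`; hence `#LK_{v̄} = 2` (`e_{v̄} = 1`) by p664385.
presearch: Rubin LNM 1716 §3 Lemma 3.6 (ii), Cor. 3.17; Agboola 2007 §3 Prop. 3.2; de Shalit II.1.7 (the local character of `E[𝔭*^∞]`) — held; no fact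
filed. beyond-print theorem: no.

References: [Rubin1999] §3 Lemma 3.6 (ii), Cor. 3.17; [Agboola2007] §3 Prop. 3.2; [deShalit1987] II.1.7.
-/

noncomputable section

open scoped Classical

set_option linter.dupNamespace false
set_option autoImplicit false

namespace Summit.BirchSwinnertonDyer.BirchSwinnertonDyer.Theorems.PrintCf2.RestrictedSelmerPair

open NumberField IsDedekindDomain Field WeierstrassCurve
open Literature.NumberTheory.EllipticCurves Literature.NumberTheory.EllipticCurves.GreenbergSelmer
open Literature.NumberTheory.GaloisRepresentations
open Summit.BirchSwinnertonDyer.BirchSwinnertonDyer.Theorems.PrintCf2.AdditiveAtSeven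
open Summit.BirchSwinnertonDyer.BirchSwinnertonDyer.Theorems.PrintCf2.CMPrimes

variable {K : Type} [Field K] [NumberField K]

/-- An element acting on a point of order `8` both as `±3` and as `±1` does not exist. [folklore] -/
theorem false_of_smul_eq_three_of_smul_eq_pm {A : Type*} [AddCommGroup A] {g x : A} (hord : addOrderOf g = 2 ^ 3)
    {N : ℤ} (hN : N = 3 ∨ N = -3) (hact : x = N • g) (hpm : x = g ∨ x = -g) : False := by
  have h4 : (4 : ℤ) • g = 0 := by
    rcases hN with rfl | rfl <;> rcases hpm with h | h <;> rw [hact] at h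
    · have h2 : (2 : ℤ) • g = 0 := by rw [show (2 : ℤ) = 3 - 1 by norm_num, sub_smul, one_smul, h, sub_self]
      rw [show (4 : ℤ) = 2 * 2 by norm_num, mul_smul, h2, smul_zero]
    · rw [show (4 : ℤ) = 3 + 1 by norm_num, add_smul, one_smul, h, neg_add_cancel]
    · have h4' : (-4 : ℤ) • g = 0 := by rw [show (-4 : ℤ) = -3 - 1 by norm_num, sub_smul, one_smul, h, sub_self]
      rw [show (4 : ℤ) = -(-4) by norm_num, neg_smul, h4', neg_zero]
    · have h2 : (-2 : ℤ) • g = 0 := by rw [show (-2 : ℤ) = -3 + 1 by norm_num, add_smul, one_smul, h, neg_add_cancel]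
      rw [show (4 : ℤ) = (-2) * (-2) by norm_num, mul_smul, h2, smul_zero]
  have hdvd : (addOrderOf g : ℤ) ∣ 4 := addOrderOf_dvd_iff_zsmul_eq_zero.mpr h4
  rw [hord] at hdvd
  norm_num at hdvd

/-- **(R-DYADIC) for `d ≡ 3 (mod 8)` from (C3-loc): `#LK_{v̄} = 1`.** Every `δ ∈ D_{v̄}` fixes `W*[4]` (p664023), so an element of `ker κ' ⊓ D_{v̄}` cannot act as
`−1` on `W*`; by (C3-loc) it acts as `+1`, i.e. (Hv̄-triv), and `LK_{v̄} = ⊥` (p661197). [cite: Agboola2007, §3 Prop. 3.2] [cite: Rubin1999, §3 Cor. 3.17] -/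
theorem natCard_localKer_vbar_eq_one_of_frame_of_kerC3 {d : ℤ} (hd0 : d ≠ 0) (hd8 : d % 8 = 3) (W : WeierstrassCurve ℚ) [W.IsElliptic]
    (C : VariableChange ℚ) (hC : C • W = cm7.quadraticTwist (d : ℚ)) (hK : IsImaginaryQuadratic K)
    (v vbar : HeightOneSpectrum (𝓞 K)) (hv : ((2 : ℕ) : 𝓞 K) ∈ v.asIdeal) (hvbar : ((2 : ℕ) : 𝓞 K) ∈ vbar.asIdeal)
    (hne : vbar ≠ v) (π : (W.baseChange K).endRing) (hrel : (π : AddMonoid.End (W.baseChange K).geomPoints) * π = π - 2)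
    {r : ℤ_[2]} (hr : r * r = r - 2)
    (hclause : ∀ τ ∈ GreenbergSelmer.inertia v, ∀ x : ↥((W.baseChange K).endEigenPrimaryTorsion 2 π r), τ • x = x ∨ τ • x = -x)
    (κ' : ZpExtension K 2)
    (hC3 : ∀ σ ∈ decomp vbar, σ ∈ κ'.kerSubgroup ↔
      ((∀ x : ↥((W.baseChange K).endEigenPrimaryTorsion 2 π r), σ • x = x) ∨
        (∀ x : ↥((W.baseChange K).endEigenPrimaryTorsion 2 π r), σ • x = -x))) :
    Nat.card (resOfLe ↥((W.baseChange K).endEigenPrimaryTorsion 2 π r)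
        (inf_le_inf_right (decomp vbar) (le_top : κ'.kerSubgroup ≤ ⊤))).ker = 1 := by
  haveI : Fact (Nat.Prime 2) := ⟨Nat.prime_two⟩
  have hj : W.j = -3375 := j_eq_of_smul_eq_cm7Twist hd0 W C hC
  obtain ⟨θ, hθ⟩ := exists_sq_eq_neg_seven_of_cmEndo_mem_endRing W K hj π hrel
  obtain ⟨-, -, -, -, -, -, hgen, -⟩ := endEigenPrimaryTorsion_two_structure W hj K hθ π hrel hr
  obtain ⟨g, hg, hord, -⟩ := hgen 2
  have hg4 : 4 • g = 0 := by rw [show (4 : ℕ) = 2 ^ 2 from rfl, ← hord]; exact addOrderOf_nsmul_eq_zero g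
  have hg2 : 2 • g ≠ 0 := fun h ↦ by
    have hdvd : addOrderOf g ∣ 2 := addOrderOf_dvd_of_nsmul_eq_zero h
    rw [hord] at hdvd
    exact absurd (Nat.le_of_dvd two_pos hdvd) (by norm_num)
  refine natCard_localKer_vbar_eq_one_of_frame hd0 W C hC hK v vbar hv hvbar hne π hrel hr κ' fun σ hσ x ↦ ?_
  rcases (hC3 σ hσ.2).mp hσ.1 with h | h
  · exact h x
  · exfalso
    have hfix := smul_eq_self_of_mem_decomp_vbar_of_frame hd0 hd8 W C hC hK v vbar hv hvbar hne π hrel hr hclause hg hg4 hσ.2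
    have hneg := congrArg Subtype.val (h ⟨g, hg⟩)
    change σ • g = -g at hneg
    rw [hfix] at hneg
    exact hg2 (by rw [two_nsmul]; exact add_eq_zero_iff_eq_neg.mpr hneg)

/-- **(R-DYADIC) for `d ≡ 7 (mod 8)` from (C3-loc): `#LK_{v̄} = 2`.** An element of `D_{v̄}` acting as `−1` on all of `W*` exists (`φ·τ`, `φ` of degree `1`
fixing `√(−d) ∈ K_{v̄}`, `τ` inertia with `ε(τ) = −α·ε(φ)⁻¹`: `χ(φτ) = s·ε·α⁻¹ = −1`), so by (C3-loc) it lies in `ker κ'` and moves `W*[4]`; an inertia element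
with `ε = 3` acts as `−3 ≠ ±1`, so `D_{v̄} ⊄ ker κ'`; conclude by p664385. [cite: Agboola2007, §3 Prop. 3.2] [cite: Rubin1999, §3 Lemma 3.6 (ii) and Cor. 3.17] -/
theorem natCard_localKer_vbar_eq_two_of_frame_of_kerC3 {d : ℤ} (hd0 : d ≠ 0) (hd8 : d % 8 = 7) (W : WeierstrassCurve ℚ) [W.IsElliptic]
    (C : VariableChange ℚ) (hC : C • W = cm7.quadraticTwist (d : ℚ)) (hK : IsImaginaryQuadratic K)
    (v vbar : HeightOneSpectrum (𝓞 K)) (hv : ((2 : ℕ) : 𝓞 K) ∈ v.asIdeal) (hvbar : ((2 : ℕ) : 𝓞 K) ∈ vbar.asIdeal)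
    (hne : vbar ≠ v) (π : (W.baseChange K).endRing) (hrel : (π : AddMonoid.End (W.baseChange K).geomPoints) * π = π - 2)
    {r : ℤ_[2]} (hr : r * r = r - 2)
    (hclause : ∀ τ ∈ GreenbergSelmer.inertia v, ∀ x : ↥((W.baseChange K).endEigenPrimaryTorsion 2 π r), τ • x = x ∨ τ • x = -x)
    (κ' : ZpExtension K 2)
    (hC3 : ∀ σ ∈ decomp vbar, σ ∈ κ'.kerSubgroup ↔
      ((∀ x : ↥((W.baseChange K).endEigenPrimaryTorsion 2 π r), σ • x = x) ∨
        (∀ x : ↥((W.baseChange K).endEigenPrimaryTorsion 2 π r), σ • x = -x))) :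
    Nat.card (resOfLe ↥((W.baseChange K).endEigenPrimaryTorsion 2 π r)
        (inf_le_inf_right (decomp vbar) (le_top : κ'.kerSubgroup ≤ ⊤))).ker = 2 := by
  haveI : Fact (Nat.Prime 2) := ⟨Nat.prime_two⟩
  have hj : W.j = -3375 := j_eq_of_smul_eq_cm7Twist hd0 W C hC
  obtain ⟨θ, hθ⟩ := exists_sq_eq_neg_seven_of_cmEndo_mem_endRing W K hj π hrel
  have hK2 : Module.finrank ℚ K = 2 := hK.1
  obtain ⟨-, -, -, -, -, -, hgen, -⟩ := endEigenPrimaryTorsion_two_structure W hj K hθ π hrel hr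
  -- the kernel-type clause (R) at `v̄` for `E[𝔮_r^∞]`
  obtain ⟨hcl', -⟩ := endEigenPrimaryTorsion_two_pinningClause_swap W K hj hK hθ π hrel hr hv hvbar hne hclause
  have hcl'' : ∀ τ ∈ GreenbergSelmer.inertia vbar, ∀ y ∈ (W.baseChange K).endEigenPrimaryTorsion 2 π (1 - r),
      τ • y = y ∨ τ • y = -y := fun τ hτ y hy ↦ by
    rcases hcl' τ hτ ⟨y, hy⟩ with h | h
    · exact Or.inl (congrArg Subtype.val h)
    · exact Or.inr (congrArg Subtype.val h)
  have h1r : (1 - r) * (1 - r) = (1 - r) - 2 := by linear_combination hr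
  have hdQ : (d : ℚ) ≠ 0 := by exact_mod_cast hd0
  obtain ⟨α, hα, -, hUR⟩ := endEigenPrimaryTorsion_two_localTypes_named_of_pinned W K hj hθ π hrel h1r hdQ C hC vbar hvbar
    (inertiaDeg_eq_one_of_ne_two K hK2 hvbar hv hne.symm) hcl''
  simp only [sub_sub_cancel] at hUR
  have HR := fun σ n hσ s hs ↦ (hUR σ n hσ s hs).2
  -- Step 1: `D_{v̄} ⊄ ker κ'` — an inertia element with `ε = 3` acts as `−3`
  have hu3 : IsUnit ((3 : ℤ) : ℤ_[2]) := by
    rw [PadicInt.isUnit_iff]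
    refine le_antisymm (PadicInt.norm_le_one _) (not_lt.mp fun hlt ↦ ?_)
    have h3 : (2 : ℤ) ∣ 3 := by exact_mod_cast (PadicInt.norm_int_lt_one_iff_dvd (p := 2) 3).mp hlt
    omega
  obtain ⟨g3, hg3, hord3, -⟩ := hgen 3
  have hw : ¬ decomp vbar ≤ κ'.kerSubgroup := by
    obtain ⟨τ, hτI, hτχ⟩ := ZpExtension.exists_mem_inertia_cyclotomicCharacter_eq_of_split hK2 hv hvbar hne
      (adicCompletionPrime_mem_primesAbove K vbar) hu3.unit
    rw [inertia_adicCompletionPrime_eq_map_absInertia K vbar, Subgroup.mem_map] at hτI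
    obtain ⟨σ, hσI, hστ⟩ := hτI
    have hτχ' : GaloisRep.cyclotomicCharacter K 2 (absGaloisRestrict K (vbar.adicCompletion K) σ) = hu3.unit := by rw [← hτχ]; exact congrArg _ hστ
    have hσ0 : IsFrobPow σ ((0 : ℕ) : ℤ) := by exact_mod_cast isFrobPow_zero_iff_mem_absInertia.mpr hσI
    intro hle
    have hmem : absGaloisRestrict K (vbar.adicCompletion K) σ ∈ κ'.kerSubgroup := hle ⟨σ, rfl⟩
    have h8 : 2 ^ 3 • g3 = 0 := by rw [← hord3]; exact addOrderOf_nsmul_eq_zero g3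
    -- the sign `s` of `res σ` on `ι√d` and the action `3s` on `W*[8]`
    obtain ⟨s, hs, hs1⟩ : ∃ s : ℤ, ((absGaloisRestrict K (vbar.adicCompletion K) σ • absClosureEmbedding ℚ K (WeierstrassCurve.geomSqrt (d : ℚ)) =
          absClosureEmbedding ℚ K (WeierstrassCurve.geomSqrt (d : ℚ)) ∧ s = 1) ∨
        (absGaloisRestrict K (vbar.adicCompletion K) σ • absClosureEmbedding ℚ K (WeierstrassCurve.geomSqrt (d : ℚ)) =
          -absClosureEmbedding ℚ K (WeierstrassCurve.geomSqrt (d : ℚ)) ∧ s = -1)) ∧ (s = 1 ∨ s = -1) := by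
      rcases smul_absClosureEmbedding_geomSqrt_eq_or K (d : ℚ) (absGaloisRestrict K (vbar.adicCompletion K) σ) with hA | hA
      · exact ⟨1, Or.inl ⟨hA, rfl⟩, Or.inl rfl⟩
      · exact ⟨-1, Or.inr ⟨hA, rfl⟩, Or.inr rfl⟩
    have hact := HR σ 0 hσ0 s hs 3 g3 hg3 h8 (3 * s) (by
      have h0 : (((3 * s : ℤ)) : ℤ_[2]) - s * ((GaloisRep.cyclotomicCharacter K 2
          (absGaloisRestrict K (vbar.adicCompletion K) σ) * (α⁻¹) ^ 0 : ℤ_[2]ˣ) : ℤ_[2]) = 0 := by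
        rw [pow_zero, mul_one, hτχ', IsUnit.unit_spec]; push_cast; ring
      rw [h0]; exact Ideal.zero_mem _)
    have hN : 3 * s = 3 ∨ 3 * s = -3 := by rcases hs1 with rfl | rfl <;> norm_num
    rcases (hC3 _ ⟨σ, rfl⟩).mp hmem with h | h
    · exact false_of_smul_eq_three_of_smul_eq_pm hord3 hN hact (Or.inl (congrArg Subtype.val (h ⟨g3, hg3⟩)))
    · exact false_of_smul_eq_three_of_smul_eq_pm hord3 hN hact (Or.inr (congrArg Subtype.val (h ⟨g3, hg3⟩)))
  -- Step 2: an element `σ = φ·τ` of `D_{v̄}` acting as `−1` on all of `W*`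
  obtain ⟨φ, hφ1⟩ := exists_isFrobPow_holds (F := vbar.adicCompletion K) 1
  have hd7 : (-d) % 8 = 1 := by omega
  obtain ⟨sK, hsK⟩ := exists_sq_eq_adicCompletion_of_emod_eight K vbar hvbar hd7
  have hBfix : absGaloisRestrict K (vbar.adicCompletion K) φ • WeierstrassCurve.geomSqrt ((-d : ℤ) : K) = WeierstrassCurve.geomSqrt ((-d : ℤ) : K) := by
    refine absGaloisRestrict_smul_eq_of_mem_range K vbar φ ?_
    have hιB : (absClosureEmbedding K (vbar.adicCompletion K) (WeierstrassCurve.geomSqrt ((-d : ℤ) : K))) ^ 2 =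
        (algebraMap (vbar.adicCompletion K) (AlgebraicClosure (vbar.adicCompletion K)) sK) ^ 2 := by
      rw [← map_pow, WeierstrassCurve.geomSqrt_sq, AlgHom.commutes, ← map_pow, hsK, ← IsScalarTower.algebraMap_apply K (vbar.adicCompletion K) (AlgebraicClosure (vbar.adicCompletion K))]
    rcases sq_eq_sq_iff_eq_or_eq_neg.mp hιB with h | h
    · exact ⟨sK, h.symm⟩
    · exact ⟨-sK, by rw [map_neg, h]⟩
  -- signs of `φ`: `s_φ · e_φ = 1`
  obtain ⟨sφ, eφ, hsφ, heφ, hse⟩ : ∃ sφ eφ : ℤ,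
      ((absGaloisRestrict K (vbar.adicCompletion K) φ • absClosureEmbedding ℚ K (WeierstrassCurve.geomSqrt (d : ℚ)) =
          absClosureEmbedding ℚ K (WeierstrassCurve.geomSqrt (d : ℚ)) ∧ sφ = 1) ∨
        (absGaloisRestrict K (vbar.adicCompletion K) φ • absClosureEmbedding ℚ K (WeierstrassCurve.geomSqrt (d : ℚ)) =
          -absClosureEmbedding ℚ K (WeierstrassCurve.geomSqrt (d : ℚ)) ∧ sφ = -1)) ∧
      ((absGaloisRestrict K (vbar.adicCompletion K) φ • absClosureEmbedding ℚ K (WeierstrassCurve.geomSqrt (-1 : ℚ)) =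
          absClosureEmbedding ℚ K (WeierstrassCurve.geomSqrt (-1 : ℚ)) ∧ eφ = 1) ∨
        (absGaloisRestrict K (vbar.adicCompletion K) φ • absClosureEmbedding ℚ K (WeierstrassCurve.geomSqrt (-1 : ℚ)) =
          -absClosureEmbedding ℚ K (WeierstrassCurve.geomSqrt (-1 : ℚ)) ∧ eφ = -1)) ∧ sφ * eφ = 1 := by
    rcases smul_absClosureEmbedding_geomSqrt_eq_or K (d : ℚ) (absGaloisRestrict K (vbar.adicCompletion K) φ) with hA | hA <;>
      rcases smul_absClosureEmbedding_geomSqrt_eq_or K (-1 : ℚ) (absGaloisRestrict K (vbar.adicCompletion K) φ) with hZ | hZ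
    · exact ⟨1, 1, Or.inl ⟨hA, rfl⟩, Or.inl ⟨hZ, rfl⟩, by norm_num⟩
    · exact ⟨1, -1, Or.inl ⟨hA, rfl⟩, Or.inr ⟨hZ, rfl⟩,
        sign_mul_eq_of_smul_geomSqrt K hd0 _ (Or.inl ⟨hA, rfl⟩) (Or.inr ⟨hZ, rfl⟩) (Or.inl ⟨hBfix, rfl⟩)⟩
    · exact ⟨-1, 1, Or.inr ⟨hA, rfl⟩, Or.inl ⟨hZ, rfl⟩,
        sign_mul_eq_of_smul_geomSqrt K hd0 _ (Or.inr ⟨hA, rfl⟩) (Or.inl ⟨hZ, rfl⟩) (Or.inl ⟨hBfix, rfl⟩)⟩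
    · exact ⟨-1, -1, Or.inr ⟨hA, rfl⟩, Or.inr ⟨hZ, rfl⟩, by norm_num⟩
  -- Step 3: the inertia partner `τ` with `ε(τ) = c`, `c := −s_φ·α·ε(φ)⁻¹ ≡ 1 (mod 4)`
  set εφ : ℤ_[2]ˣ := GaloisRep.cyclotomicCharacter K 2 (absGaloisRestrict K (vbar.adicCompletion K) φ) with hεφ
  have hsφ1 : sφ = 1 ∨ sφ = -1 := by rcases hsφ with ⟨-, h⟩ | ⟨-, h⟩ <;> simp [h]
  set c : ℤ_[2]ˣ := if sφ = 1 then -(α * εφ⁻¹) else α * εφ⁻¹ with hc_def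
  have hεinv : (εφ : ℤ_[2]) * ((εφ⁻¹ : ℤ_[2]ˣ) : ℤ_[2]) = 1 := by rw [← Units.val_mul, mul_inv_cancel, Units.val_one]
  have hαinv : (α : ℤ_[2]) * ((α⁻¹ : ℤ_[2]ˣ) : ℤ_[2]) = 1 := by rw [← Units.val_mul, mul_inv_cancel, Units.val_one]
  -- the key identity `s_φ · ε(φ) · c · α⁻¹ = −1`
  have hkey : (sφ : ℤ_[2]) * (((εφ * c) * α⁻¹ : ℤ_[2]ˣ) : ℤ_[2]) = -1 := by
    rcases hsφ1 with h1 | h1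
    · rw [hc_def]; simp only [h1, if_true, Units.val_mul, Units.val_neg, Int.cast_one, one_mul]
      linear_combination (-(α : ℤ_[2]) * ((α⁻¹ : ℤ_[2]ˣ) : ℤ_[2])) * hεinv - hαinv
    · rw [hc_def]; simp only [h1, show (-1 : ℤ) ≠ 1 by norm_num, if_false, Units.val_mul, Int.cast_neg, Int.cast_one]
      linear_combination (-(α : ℤ_[2]) * ((α⁻¹ : ℤ_[2]ˣ) : ℤ_[2])) * hεinv - hαinv
  -- `c ≡ 1 (mod 4)`: `ε(φ) ≡ e_φ`, `α ≡ −1`, `s_φ e_φ = 1`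
  have hc4 : ((c : ℤ_[2]ˣ) : ℤ_[2]) - 1 ∈ (Ideal.span {(2 : ℤ_[2]) ^ 2} : Ideal ℤ_[2]) := by
    have h2 : (2 : ℤ_[2]) = ((2 : ℕ) : ℤ_[2]) := by norm_cast
    have hεe : PadicInt.toZModPow 2 ((εφ : ℤ_[2]ˣ) : ℤ_[2]) = (eφ : ZMod (2 ^ 2)) := by
      obtain ⟨hZ, rfl⟩ | ⟨hZ, rfl⟩ := heφ
      · have h := (cyclotomicCharacter_mem_span_four_of_smul_geomSqrt_neg_one K (absGaloisRestrict K (vbar.adicCompletion K) φ)).1 hZ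
        rw [h2, ← PadicInt.ker_toZModPow, RingHom.mem_ker, map_sub, map_one, sub_eq_zero] at h
        rw [h, Int.cast_one]
      · have h := (cyclotomicCharacter_mem_span_four_of_smul_geomSqrt_neg_one K (absGaloisRestrict K (vbar.adicCompletion K) φ)).2 hZ
        rw [h2, ← PadicInt.ker_toZModPow, RingHom.mem_ker, map_add, map_one] at h
        rw [Int.cast_neg, Int.cast_one, eq_neg_iff_add_eq_zero, h]
    have hεinv' : PadicInt.toZModPow 2 ((εφ⁻¹ : ℤ_[2]ˣ) : ℤ_[2]) = (eφ : ZMod (2 ^ 2)) := by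
      have h := congrArg (PadicInt.toZModPow 2) hεinv
      rw [map_mul, map_one, hεe] at h
      have he1 : eφ = 1 ∨ eφ = -1 := by rcases heφ with ⟨-, h⟩ | ⟨-, h⟩ <;> simp [h]
      rcases he1 with h1 | h1 <;> rw [h1] at h ⊢ <;> push_cast at h ⊢
      · linear_combination h
      · linear_combination -h
    have hα4 := (toZModPow_two_unitRoot hα).1
    rw [h2, ← PadicInt.ker_toZModPow, RingHom.mem_ker, map_sub, map_one, sub_eq_zero]
    have hse' : (sφ : ZMod (2 ^ 2)) * eφ = 1 := by exact_mod_cast congrArg (Int.cast : ℤ → ZMod (2 ^ 2)) hse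
    rcases hsφ1 with h1 | h1
    · rw [hc_def]; simp only [h1, if_true, Units.val_neg, Units.val_mul, map_neg, map_mul, hα4, hεinv']
      rw [h1, Int.cast_one, one_mul] at hse'
      rw [hse']; ring
    · rw [hc_def]; simp only [h1, show (-1 : ℤ) ≠ 1 by norm_num, if_false, Units.val_mul, map_mul, hα4, hεinv']
      rw [h1] at hse'; push_cast at hse'
      linear_combination hse'
  obtain ⟨τ, hτI, hτχ⟩ := ZpExtension.exists_mem_inertia_cyclotomicCharacter_eq_of_split hK2 hv hvbar hne
    (adicCompletionPrime_mem_primesAbove K vbar) c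
  rw [inertia_adicCompletionPrime_eq_map_absInertia K vbar, Subgroup.mem_map] at hτI
  obtain ⟨στ, hστI, hσττ⟩ := hτI
  have hτχ' : GaloisRep.cyclotomicCharacter K 2 (absGaloisRestrict K (vbar.adicCompletion K) στ) = c := by rw [← hτχ]; exact congrArg _ hσττ
  have hτ0 : IsFrobPow στ ((0 : ℕ) : ℤ) := by exact_mod_cast isFrobPow_zero_iff_mem_absInertia.mpr hστI
  -- `τ` fixes `ζ₄` (as `ε(τ) ≡ 1 (mod 4)`) and `√(−d)` (file 5 (U1)), hence `ι√d`
  have hZτ : absGaloisRestrict K (vbar.adicCompletion K) στ • absClosureEmbedding ℚ K (WeierstrassCurve.geomSqrt (-1 : ℚ)) =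
      absClosureEmbedding ℚ K (WeierstrassCurve.geomSqrt (-1 : ℚ)) := by
    rcases smul_absClosureEmbedding_geomSqrt_eq_or K (-1 : ℚ) (absGaloisRestrict K (vbar.adicCompletion K) στ) with h | h
    · exact h
    · exfalso
      have hm := (cyclotomicCharacter_mem_span_four_of_smul_geomSqrt_neg_one K (absGaloisRestrict K (vbar.adicCompletion K) στ)).2 h
      rw [hτχ'] at hm
      have : (2 : ℤ_[2]) ∈ (Ideal.span {(2 : ℤ_[2]) ^ 2} : Ideal ℤ_[2]) := by
        have := Ideal.sub_mem _ hm hc4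
        rwa [show ((c : ℤ_[2]ˣ) : ℤ_[2]) + 1 - (((c : ℤ_[2]ˣ) : ℤ_[2]) - 1) = 2 by ring] at this
      exact two_not_mem_span_four this
  have hBτ := smul_geomSqrt_eq_of_mem_absInertia_of_emod_four_eq_one vbar hvbar (u := -d) (by omega) hστI
  have hAτ : absGaloisRestrict K (vbar.adicCompletion K) στ • absClosureEmbedding ℚ K (WeierstrassCurve.geomSqrt (d : ℚ)) =
      absClosureEmbedding ℚ K (WeierstrassCurve.geomSqrt (d : ℚ)) := by
    rcases smul_absClosureEmbedding_geomSqrt_eq_or K (d : ℚ) (absGaloisRestrict K (vbar.adicCompletion K) στ) with h | h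
    · exact h
    · have hse1 := sign_mul_eq_of_smul_geomSqrt K hd0 _ (s := -1) (e := 1) (Or.inr ⟨h, rfl⟩) (Or.inl ⟨hZτ, rfl⟩) (Or.inl ⟨hBτ, rfl⟩)
      norm_num at hse1
  -- Step 4: `σ = φ·τ` has degree `1`, sign `s_φ` on `ι√d`, and acts as `−1` on all of `W*`
  have hσ1 : IsFrobPow (φ * στ) ((1 : ℕ) : ℤ) := by
    have h := IsFrobPow.mul_holds hφ1 (isFrobPow_zero_iff_mem_absInertia.mpr hστI)
    rw [add_zero] at h
    exact_mod_cast h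
  have hsσ : (absGaloisRestrict K (vbar.adicCompletion K) (φ * στ) • absClosureEmbedding ℚ K (WeierstrassCurve.geomSqrt (d : ℚ)) =
        absClosureEmbedding ℚ K (WeierstrassCurve.geomSqrt (d : ℚ)) ∧ sφ = 1) ∨
      (absGaloisRestrict K (vbar.adicCompletion K) (φ * στ) • absClosureEmbedding ℚ K (WeierstrassCurve.geomSqrt (d : ℚ)) =
        -absClosureEmbedding ℚ K (WeierstrassCurve.geomSqrt (d : ℚ)) ∧ sφ = -1) := by
    rw [map_mul, mul_smul, hAτ]
    exact hsφ
  have hneg : ∀ x : ↥((W.baseChange K).endEigenPrimaryTorsion 2 π r), absGaloisRestrict K (vbar.adicCompletion K) (φ * στ) • x = -x := by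
    intro x
    obtain ⟨k, hk⟩ := (AddCommGroup.mem_primaryComponent).mp (x : (W.baseChange K).geomPrimaryTorsion 2).2
    have hxk : 2 ^ k • (x : (W.baseChange K).geomPrimaryTorsion 2) = 0 :=
      Subtype.ext (by rw [AddSubmonoidClass.coe_nsmul, ZeroMemClass.coe_zero]; exact hk)
    have hmem : (((-1 : ℤ) : ℤ_[2]) - sφ * ((GaloisRep.cyclotomicCharacter K 2 (absGaloisRestrict K (vbar.adicCompletion K) (φ * στ)) * (α⁻¹) ^ 1 :
        ℤ_[2]ˣ) : ℤ_[2])) ∈ (Ideal.span {(2 : ℤ_[2]) ^ k} : Ideal ℤ_[2]) := by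
      rw [map_mul, map_mul, ← hεφ, hτχ', pow_one, hkey]
      simp
    have h := HR (φ * στ) 1 hσ1 sφ hsσ k x x.2 hxk (-1) hmem
    exact Subtype.ext (by rw [neg_one_zsmul] at h; exact h)
  -- Step 5: (Hv̄-move) and conclusion
  have hker : absGaloisRestrict K (vbar.adicCompletion K) (φ * στ) ∈ κ'.kerSubgroup := (hC3 _ ⟨φ * στ, rfl⟩).mpr (Or.inr hneg)
  obtain ⟨g, hg, hord, -⟩ := hgen 2
  have hg4 : 4 • g = 0 := by rw [show (4 : ℕ) = 2 ^ 2 from rfl, ← hord]; exact addOrderOf_nsmul_eq_zero g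
  have hg2 : 2 • g ≠ 0 := fun h ↦ by
    have hdvd : addOrderOf g ∣ 2 := addOrderOf_dvd_of_nsmul_eq_zero h
    rw [hord] at hdvd
    exact absurd (Nat.le_of_dvd two_pos hdvd) (by norm_num)
  have hmove : ∃ σ ∈ κ'.kerSubgroup ⊓ decomp vbar, ∃ x : ↥((W.baseChange K).endEigenPrimaryTorsion 2 π r), 4 • x = 0 ∧ σ • x ≠ x := by
    refine ⟨absGaloisRestrict K (vbar.adicCompletion K) (φ * στ), ⟨hker, ⟨φ * στ, rfl⟩⟩, ⟨g, hg⟩, Subtype.ext (by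
      rw [AddSubmonoidClass.coe_nsmul, ZeroMemClass.coe_zero]; exact hg4), fun h ↦ hg2 ?_⟩
    rw [hneg] at h
    have h' := congrArg Subtype.val h
    change -g = g at h'
    rw [two_nsmul]
    exact add_eq_zero_iff_eq_neg.mpr h'.symm
  exact natCard_localKer_vbar_eq_two_of_frame hd0 W C hC vbar π hrel hr κ' hmove hw


end Summit.BirchSwinnertonDyer.BirchSwinnertonDyer.Theorems.PrintCf2.RestrictedSelmerPair

end
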